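import Mathlib
import Summits.NavierStokesRegularity.NavierStokesRegularity.Theorems.TaoLadderRungTwoBreakBlowupRigidityOneQuietShell
import HarnessLib

/-!
# Every HIGH shell of every viscous companion of a robust blow-up exceeds EVERY sub-(S₁) envelope — the `liminf` form
  of the dissipation threshold for `stub_eternalFromBlowup` (K2(1) `TaoLadderRungTwoBreak.BlowupRigidityOne`,
  stmt-NavierStokesRegularity-20206)

MODEL lattice ODEs only (Tao 2016 §4: the NS-scaled viscous lattice before Theorem 4.2, (4.3), Lemma 4.1 (4.5)); nothing
here is a statement about the Navier–Stokes equations; NO item is closed (`--supports stmt-NavierStokesRegularity-20206`).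
Route-independent, general `m`, DEF-FREE. Fourth module of the dissipation-threshold series: `…SubcriticalCeiling`
(no sub-(S₁) ceiling: SOME shell exceeds it), `…SubcriticalCeilingSurvival` (infinitely many shells), `…CriticalCeiling`
(small critical ceilings), `…QuietShell` (ONE (S₁)-quiet shell regularises; every shell (S₁)-loud at level `B₁(ν̂)`).

* `weight45_bounded_of_oneSubcriticalShell` — ONE shell `n` under a sub-(S₁) bound `‖x_n(t)‖ ≤ B ν^n`, `(1+ε₀)ν² < 1`,
  `B` ARBITRARY, regularises the `ν̂`-viscous flow as soon as `n` is large: precisely when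
  `(C_A B²)²/(ν̂²(1+ε₀)³) · ((1+ε₀)ν²)^{2n} ≤ B₁²`, `B₁ = ν̂/(2(C_A+1)(1+ε₀)^9)` (tail bound `tail_norm_le_of_shellBound` makes
  shell `n+1` (S₁)-quiet at level `B₁`, then `weight45_bounded_of_oneQuietShell`);
* `loudHighShells_of_noGlobalCascade` — **ROBUST BLOW-UP ⇒ for every `0 < ν̂ ≤ κ/√2`, every `B` and every rate `ν` with
  `(1+ε₀)ν² < 1` there is `N` such that EVERY shell `n ≥ N` of the maximal `ν̂`-viscous flow has a time `t < T` with
  `‖x_n(t)‖ > B ν^n`**: `liminf_n sup_t ‖x_n(t)‖^{1/n} ≥ (1+ε₀)^{-1/2}` along every viscous companion (the earlier modules gave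
  the `limsup` and the level-`B₁(ν̂)` statement at the endpoint).

HONEST LABEL: no stub, crux or summit is proved; inviscid flow and ω-limit untouched; rung 0.
-/

noncomputable section

-- the summit and its single sub-problem share the name (CONVENTIONS §1)
set_option linter.dupNamespace false

open Set Filter Topology

namespace Summit.NavierStokesRegularity.NavierStokesRegularity.Theorems

namespace BlowupRigidityOne

open Literature.Analysis.FluidPDE Literature.Analysis.FluidPDE.TaoCascade

variable {m : ℕ}

/-- **ONE SUB-(S₁)-BOUNDED HIGH SHELL ⇒ (4.5)-REGULAR.** `ν̂ > 0`, `α` cancelling, `X` a `ν̂`-viscous flow on `[0,T)` from the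
one-shell datum at shell `0` (no shells below `0`, (4.5)-regular before `T`); if one shell `n` obeys `‖x_n(t)‖ ≤ B ν^n` on
`[0,T)` with `0 < ν` and `(C_A B²)²/(ν̂²(1+ε₀)³)·(((1+ε₀)ν²)²)^n ≤ B₁²`, `B₁ = ν̂/(2(C_A+1)(1+ε₀)^9)`, then the (4.5) norm
is bounded on `[0,T)`. [cite: Tao2016AveragedNS, §4 (4.3), Lemma 4.1 (4.5) and the viscous equation before Thm. 4.2; Cheskidov2008, §4 (analogy)] -/
theorem weight45_bounded_of_oneSubcriticalShell {ε₀ visc T B ν : ℝ} (hε : 0 < ε₀) (hvisc : 0 < visc)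
    {α : Fin m → Fin m → Fin m → ℤ × ℤ × ℤ → ℝ} (hc : IsCancellingCoeff α)
    {X : Fin m → ℤ → ℝ → ℝ} {X₀ : Fin m → ℝ}
    (hC1 : ∀ i n, ContDiffOn ℝ 1 (X i n) (Set.Ico 0 T))
    (hinit : ∀ i n, X i n 0 = if n = 0 then X₀ i else 0)
    (hlow : ∀ i n t, n < 0 → X i n t = 0)
    (hmot : ∀ i n t, 0 ≤ t → t < T → derivWithin (X i n) (Set.Ici 0) t =
      quadTerm ε₀ α X i n t - visc * (1 + ε₀) ^ ((2 : ℝ) * n) * X i n t)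
    (hreg : ∀ T' : ℝ, 0 < T' → T' < T → ∃ M : ℝ, ∀ t : ℝ, 0 ≤ t → t ≤ T' →
      ∀ (i : Fin m) (n : ℤ), (1 + (1 + ε₀) ^ ((10 : ℝ) * n)) * |X i n t| ≤ M)
    (hν : 0 < ν) {n : ℕ}
    (hsmall : (shiftConst α (0, 0, 1) * B ^ 2) ^ 2 / (visc ^ 2 * (1 + ε₀) ^ 3) * (((1 + ε₀) * ν ^ 2) ^ 2) ^ n ≤
      (visc / (2 * (shiftConst α (0, 0, 1) + 1) * (1 + ε₀) ^ 9)) ^ 2)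
    (hshell : ∀ t : ℝ, 0 ≤ t → t < T → ‖shellVec X (n : ℤ) t‖ ≤ B * ν ^ n) :
    ∃ M : ℝ, ∀ t : ℝ, 0 ≤ t → t < T → ∀ (i : Fin m) (k : ℤ),
      (1 + (1 + ε₀) ^ ((10 : ℝ) * k)) * |X i k t| ≤ M := by
  have hb : (0 : ℝ) < 1 + ε₀ := by linarith
  have hC0 : 0 ≤ shiftConst α (0, 0, 1) := shiftConst_nonneg α _
  have hB₁ : 0 < visc / (2 * (shiftConst α (0, 0, 1) + 1) * (1 + ε₀) ^ 9) := by positivity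
  -- the tail bound makes shell `n+1` (S₁)-quiet at level `B₁`
  have htail := tail_norm_le_of_shellBound hε hvisc hc hC1 hinit hmot hreg hshell (n + 1) n.lt_succ_self
  have hquiet : ∀ t : ℝ, 0 ≤ t → t < T →
      (1 + ε₀) ^ (n + 1) * ‖shellVec X ((n + 1 : ℕ) : ℤ) t‖ ^ 2 ≤
        (visc / (2 * (shiftConst α (0, 0, 1) + 1) * (1 + ε₀) ^ 9)) ^ 2 := by
    intro t ht htT
    have h1 := htail t ht htT
    have h2 : ‖shellVec X ((n + 1 : ℕ) : ℤ) t‖ ^ 2 ≤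
        (bigLam ε₀ ^ n * shiftConst α (0, 0, 1) * (B * ν ^ n) ^ 2 / (visc * (1 + ε₀) ^ (2 * (n + 1)))) ^ 2 :=
      pow_le_pow_left₀ (norm_nonneg _) h1 2
    have hrn : (((1 + ε₀) * ν ^ 2) ^ 2) ^ n = ((1 + ε₀) ^ n) ^ 2 * ((ν ^ n) ^ 2) ^ 2 := by
      conv_lhs => rw [pow_right_comm, mul_pow, mul_pow, ← pow_mul ν 2 n, mul_comm 2 n, pow_mul]
    have e : (1 + ε₀) ^ (n + 1) *
        (bigLam ε₀ ^ n * shiftConst α (0, 0, 1) * (B * ν ^ n) ^ 2 / (visc * (1 + ε₀) ^ (2 * (n + 1)))) ^ 2 =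
        (shiftConst α (0, 0, 1) * B ^ 2) ^ 2 / (visc ^ 2 * (1 + ε₀) ^ 3) * (((1 + ε₀) ^ n) ^ 2 * ((ν ^ n) ^ 2) ^ 2) := by
      rw [div_pow, mul_pow, mul_pow, bigLam_pow_sq hε.le n]
      field_simp
      ring
    have hsmall' := hsmall
    rw [hrn] at hsmall'
    calc (1 + ε₀) ^ (n + 1) * ‖shellVec X ((n + 1 : ℕ) : ℤ) t‖ ^ 2
        ≤ (1 + ε₀) ^ (n + 1) *
          (bigLam ε₀ ^ n * shiftConst α (0, 0, 1) * (B * ν ^ n) ^ 2 / (visc * (1 + ε₀) ^ (2 * (n + 1)))) ^ 2 :=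
          mul_le_mul_of_nonneg_left h2 (pow_pos hb _).le
      _ = _ := e
      _ ≤ _ := hsmall'
  exact weight45_bounded_of_oneQuietShell hε hvisc hc hC1 hinit hlow hmot hreg hB₁.le le_rfl hquiet

/-- **ROBUST BLOW-UP ⇒ EVERY HIGH SHELL OF EVERY VISCOUS COMPANION EXCEEDS EVERY SUB-(S₁) ENVELOPE.** If
`NoGlobalCascade ε₀ α X₀` (`ε₀ > 0`, `α ∈ E₂(R)`, any `m`), there is `κ > 0` such that for every viscosity `0 < ν̂ ≤ κ/√2`
the maximal `ν̂`-viscous flow from the one-shell datum (datum, no shells below `0`, viscous motion, (4.5)-regular before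
`T`, (4.5) norm unbounded) satisfies: for every `B` and every `0 < ν` with `(1+ε₀)ν² < 1` there is `N` such that EVERY shell
`n ≥ N` has a time `t ∈ [0,T)` with `B ν^n < ‖x_n(t)‖` (liminf form of the dissipation threshold).
[cite: Tao2016AveragedNS, §4 Thm. 4.2, the viscous equation before Thm. 4.2, Lemma 4.1 (4.5); Teschl2012, §2.6 Cor. 2.16] -/
theorem loudHighShells_of_noGlobalCascade {ε₀ R : ℝ} (hε : 0 < ε₀)
    {α : Fin m → Fin m → Fin m → ℤ × ℤ × ℤ → ℝ} {X₀ : Fin m → ℝ} (hα : InTableClass R α)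
    (hNG : NoGlobalCascade ε₀ α X₀) :
    ∃ κ : ℝ, 0 < κ ∧ ∀ visc : ℝ, 0 < visc → visc * Real.sqrt 2 ≤ κ →
      ∃ (T : ℝ) (X : Fin m → ℤ → ℝ → ℝ), 0 < T ∧
        (∀ i n, ContDiffOn ℝ 1 (X i n) (Set.Ico 0 T)) ∧
        (∀ i n, X i n 0 = if n = 0 then X₀ i else 0) ∧
        (∀ i n t, n < 0 → X i n t = 0) ∧
        (∀ i n t, 0 ≤ t → t < T → derivWithin (X i n) (Set.Ici 0) t =
          quadTerm ε₀ α X i n t - visc * (1 + ε₀) ^ ((2 : ℝ) * n) * X i n t) ∧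
        (∀ T' : ℝ, 0 < T' → T' < T → ∃ M : ℝ, ∀ t : ℝ, 0 ≤ t → t ≤ T' →
          ∀ (i : Fin m) (n : ℤ), (1 + (1 + ε₀) ^ ((10 : ℝ) * n)) * |X i n t| ≤ M) ∧
        (∀ M : ℝ, ∃ t : ℝ, 0 ≤ t ∧ t < T ∧
          ∃ (i : Fin m) (n : ℤ), M < (1 + (1 + ε₀) ^ ((10 : ℝ) * n)) * |X i n t|) ∧
        ∀ B ν : ℝ, 0 < ν → (1 + ε₀) * ν ^ 2 < 1 → ∃ N : ℕ, ∀ n : ℕ, N ≤ n →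
          ∃ t : ℝ, 0 ≤ t ∧ t < T ∧ B * ν ^ n < ‖shellVec X (n : ℤ) t‖ := by
  obtain ⟨κ, hκ, H⟩ := maximalViscousFlow_of_noGlobalCascade hε hα hNG
  refine ⟨κ, hκ, fun visc hvisc hvk => ?_⟩
  obtain ⟨T, X, hT, h1, h2, h3, h4, h5, h6⟩ := H visc hvisc.le hvk
  refine ⟨T, X, hT, h1, h2, h3, h4, h5, h6, fun B ν hν hsub => ?_⟩
  have hb : (0 : ℝ) < 1 + ε₀ := by linarith
  have hC0 : 0 ≤ shiftConst α (0, 0, 1) := shiftConst_nonneg α _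
  -- negative `B`: every shell qualifies
  rcases lt_or_ge B 0 with hBneg | -
  · refine ⟨0, fun n _ => ⟨0, le_rfl, hT, ?_⟩⟩
    have : B * ν ^ n < 0 := mul_neg_of_neg_of_pos hBneg (pow_pos hν n)
    linarith [norm_nonneg (shellVec X (n : ℤ) 0)]
  -- the threshold shell `N`: `K r^N ≤ B₁²`, `r = ((1+ε₀)ν²)² < 1`
  set r : ℝ := ((1 + ε₀) * ν ^ 2) ^ 2 with hr_def
  have hr0 : 0 ≤ r := by positivity
  have hr1 : r < 1 := by rw [hr_def]; exact pow_lt_one₀ (by positivity) hsub two_ne_zero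
  set K : ℝ := (shiftConst α (0, 0, 1) * B ^ 2) ^ 2 / (visc ^ 2 * (1 + ε₀) ^ 3) with hK_def
  have hK0 : 0 ≤ K := by positivity
  set B₁ : ℝ := visc / (2 * (shiftConst α (0, 0, 1) + 1) * (1 + ε₀) ^ 9) with hB₁_def
  have hB₁ : 0 < B₁ := by positivity
  obtain ⟨N, hN⟩ := exists_pow_lt_of_lt_one (show 0 < B₁ ^ 2 / (K + 1) by positivity) hr1
  refine ⟨N, fun n hn => ?_⟩
  by_contra hcon
  push Not at hcon
  have hsmall : K * r ^ n ≤ B₁ ^ 2 := by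
    have h1 : r ^ n ≤ r ^ N := pow_le_pow_of_le_one hr0 hr1.le hn
    have h2 : (K + 1) * r ^ N < B₁ ^ 2 := by
      have h := (lt_div_iff₀ (by positivity : (0 : ℝ) < K + 1)).1 hN
      linarith [mul_comm (r ^ N) (K + 1)]
    nlinarith [pow_nonneg hr0 N, pow_nonneg hr0 n, mul_le_mul_of_nonneg_left h1 hK0]
  obtain ⟨M, hM⟩ := weight45_bounded_of_oneSubcriticalShell hε hvisc hα.2.1 h1 h2 h3 h4 h5 hν hsmall
    (fun t ht htT => hcon t ht htT)
  obtain ⟨t, ht0, htT, i, k, hlt⟩ := h6 M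
  exact absurd (hM t ht0 htT i k) (not_le.2 hlt)

end BlowupRigidityOne

end Summit.NavierStokesRegularity.NavierStokesRegularity.Theorems

end
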